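import Summits.ResolutionOfSingularities.ResolutionOfSingularities.Theorems.MarkedTransferCampaignW46MohWindowShadeTerminal
import HarnessLib

/-!
# [OURS · L1 W4.6] Rung (iii) "Moh window" for the classical pair — the HASSE-DERIVATIVE TEST at a point of
  the exceptional divisor: an explicit coefficient of the translated initial layer bounds the new order
  (all dimensions); for surfaces, the new shade at a translated point is at most the multiplicity of the
  point as a root of the initial form of the residual factor

Cell `res-hironaka`, rung L, slot W4.6, seat `res-L1-s46-pv-6` (gen 2).  Companion of
`MarkedTransferCampaignW46MohWindowShadeDecrease.lean` (drop by the `y_j`-order of the initial residual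
form at every point of the chart `y_j`, by its `y_j`-degree at the origin).  Here the TRANSLATED points get
their sharp classical law.  Model: `PointBlowup.State/step` of `PointBlowupShade.lean` ([Hauser2010,
§§F–G]); state `(F, r)`, `y^r ∣ F`, order `o` with `p < o < 2p` (inside the window), chart `y_j`, point
`b` (`b_j = 0`).  The initial monomials `y^d` of `F` (`|d| = o`) go to the LOWEST `y_j`-layer
`y_j^{o − p}` of the chart transform, which the translation `y_l ↦ y_l + b_l` (`l ≠ j`) does not mix with
the other layers; so for an exponent `E` with `E_j = o − p` the coefficient of `y^E` in the transform is
the explicit "Hasse coefficient"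

  `λ_E = Σ_{|d| = o} c_d · ∏_{l ≠ j} C(d_l, E_l) · b_l^{d_l − E_l}`      (`0^0 = 1`),

and INSIDE THE WINDOW `y^E` is never a `p`-th power (`0 < E_j = o − p < p`), so it survives the cleaning:
* `coeff_pointTransform_layer` — `coeff_E (transform) = λ_E`;
* `ordZero_step_le_of_hasse_ne_zero` — `λ_E ≠ 0 ⟹ ord₀ F' ≤ |E|` (all dimensions);
* `shade_step_le_of_hasse_ne_zero_two_vars` — SURFACES (`σ = {j, i}`), translated point `b_i = t ≠ 0`:
  if `Σ_{|d| = o} c_d · C(d_i, k) · t^{d_i − k} ≠ 0` then `shade' ≤ k`.  The least such `k` is the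
  multiplicity of `t` as a root of `y ↦ Σ_{|d|=o} c_d (y + t)^{d_i}` = `(y + t)^{r_i} · G_a(1, y + t)`,
  i.e. of the dehomogenised initial form `G_a(1, ·)` of the residual factor: the classical "order of the
  strict transform at a point of the exceptional divisor is at most the multiplicity of that tangent
  direction", valid for the shade inside the Moh window.  In particular a stall at `t` (`shade' = a`)
  needs `G_a(1, y)` to vanish to order `a` at `t`, i.e. `G_a = c · (y_i − t y_j)^a`.
OURS; replaces — for regime (iii) of RESCUE-SEED W4.6 and the classical pair — the ROLE of the
strict-inequality clause of Th. 16.6 (2) / Eq. (127) (ms. p. 84 l. 10–20) at translated points; NOT a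
statement of the manuscript [claim: Hironaka2017, status: under-review], nothing of which is used.  AI
review is weaker than expert review.
-/

noncomputable section

set_option linter.dupNamespace false -- mandated namespace of this single-conjunct summit

open MvPolynomial Finset

open scoped BigOperators

namespace Summit.ResolutionOfSingularities.ResolutionOfSingularities.Theorems.CampaignW46.MohWindowShadeHasse

open Literature.AlgebraicGeometry.Resolution
open Literature.AlgebraicGeometry.Resolution.PointBlowup
open Literature.AlgebraicGeometry.Resolution.Hauser2010
open Literature.Barriers.ResolutionOfSingularities (ordZero_le_of_coeff_ne_zero le_ordZero_of_forall)

variable {σ : Type*} {K : Type*} [Field K] [Fintype σ] [DecidableEq σ] [DecidableEq K]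
variable (p : ℕ) [hp : Fact p.Prime] [CharP K p]

omit [DecidableEq K] hp [CharP K p] in
/-- The **Hasse coefficient** `λ_E = Σ_{|d| = o} c_d ∏_{l ≠ j} C(d_l, E_l) b_l^{d_l − E_l}` of the exponent
`E` at the point `b` of the chart `y_j` is the coefficient of `y^E` in the translated chart transform, for
every `E` in the lowest `y_j`-layer (`E_j = o − p`). [folklore] -/
theorem coeff_pointTransform_layer (j : σ) (b : σ → K) (hbj : b j = 0) (s : State σ K) {o : ℕ}
    (ho : ordZero s.F = o) (hpo : p ≤ o) (E : σ →₀ ℕ) (hEj : E j = o - p) :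
    coeff E (pointTransform p j b s) =
      ∑ d ∈ s.F.support with d.degree = o,
        coeff d s.F * ∏ l ∈ univ.erase j, (((d l).choose (E l) : K) * b l ^ (d l - E l)) := by
  classical
  have hdeg := le_degree_of_ordZero_eq s ho
  rw [pointTransform_eq_sum, coeff_sum, Finset.sum_filter]
  refine Finset.sum_congr rfl fun d hd => ?_
  rw [WeightedBlowup.coeff_translate_monomial, ← Finset.mul_prod_erase _ _ (Finset.mem_univ j),
    chartExponent_apply, if_pos rfl, hbj, hEj]
  have hprod : ∏ l ∈ univ.erase j,
      (((chartExponent p j d l).choose (E l) : K) * b l ^ (chartExponent p j d l - E l))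
      = ∏ l ∈ univ.erase j, (((d l).choose (E l) : K) * b l ^ (d l - E l)) :=
    Finset.prod_congr rfl fun l hl => by
      rw [chartExponent_apply, if_neg (Finset.ne_of_mem_erase hl)]
  rw [hprod]
  have h1 := hdeg d hd
  by_cases hdo : d.degree = o
  · rw [if_pos hdo, hdo, Nat.choose_self, Nat.sub_self, pow_zero, Nat.cast_one, mul_one, one_mul]
  · rw [if_neg hdo]
    have hlt : o - p < d.degree - p := by omega
    rw [zero_pow (by omega : d.degree - p - (o - p) ≠ 0), mul_zero, zero_mul, mul_zero]

omit hp [CharP K p] in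
/-- **[OURS · L1 W4.6] The Hasse-derivative test (all dimensions).**  Inside the window `p < o < 2p`, at the
point `b` of the chart `y_j` (`b_j = 0`): for every exponent `E` with `E_j = o − p` whose Hasse coefficient
`λ_E` is non-zero, the new residual polynomial has order `≤ |E|` — the monomial `y^E` occurs in the
transform and, `E_j` lying strictly between `0` and `p`, survives the cleaning.  NOT a statement of the
manuscript. [folklore] -/
theorem ordZero_step_le_of_hasse_ne_zero (j : σ) (b : σ → K) (hbj : b j = 0) (s : State σ K) {o : ℕ}
    (ho : ordZero s.F = o) (hlo : p < o) (hhi : o < 2 * p) (E : σ →₀ ℕ) (hEj : E j = o - p)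
    (hlam : ∑ d ∈ s.F.support with d.degree = o,
        coeff d s.F * ∏ l ∈ univ.erase j, (((d l).choose (E l) : K) * b l ^ (d l - E l)) ≠ 0) :
    ordZero (step p j b s).F ≤ E.degree := by
  classical
  have hnot : ¬ IsPthPowerExponent p E := by
    intro h
    have h1 : p ∣ E j := (isPthPowerExponent_iff p E).mp h j
    rw [hEj] at h1
    have h2 : 0 < o - p := by omega
    have := Nat.le_of_dvd h2 h1
    omega
  apply ordZero_le_of_coeff_ne_zero
  show coeff E (deletePthPowers p (pointTransform p j b s)) ≠ 0
  rw [coeff_deletePthPowers, if_neg hnot, coeff_pointTransform_layer p j b hbj s ho hlo.le E hEj]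
  exact hlam

omit hp [CharP K p] in
/-- **[OURS · L1 W4.6] SURFACES: the new shade at a translated point is bounded by the Hasse order of the
initial layer.**  For two residual variables `σ = {j, i}`, a state `(F, r)` with `y^r ∣ F` and order `o`,
`p < o < 2p`, and a TRANSLATED point `b` of the chart `y_j` (`b_j = 0`, `b_i = t ≠ 0`): if
`Σ_{|d| = o} c_d · C(d_i, k) · t^{d_i − k} ≠ 0` — the `k`-th Hasse derivative at `t` of
`y ↦ Σ_{|d| = o} c_d y^{d_i} = y^{r_i} · G_a(1, y)` — then `shade' ≤ k`.  Taking the least such `k`: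
`shade' ≤ mult_t G_a(1, ·)`, the multiplicity of the point as a root of the dehomogenised initial form of
the residual factor (the factor `y^{r_i}` does not vanish at `t ≠ 0`).  NOT a statement of the
manuscript. [folklore] -/
theorem shade_step_le_of_hasse_ne_zero_two_vars {j i : σ} (hij : i ≠ j) (htwo : ∀ l, l = j ∨ l = i)
    (b : σ → K) (hbj : b j = 0) (hbi : b i ≠ 0) (s : State σ K) {o : ℕ} (ho : ordZero s.F = o)
    (hlo : p < o) (hhi : o < 2 * p) (k : ℕ)
    (hlam : ∑ d ∈ s.F.support with d.degree = o,
        coeff d s.F * (((d i).choose k : K) * b i ^ (d i - k)) ≠ 0) :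
    (step p j b s).shade ≤ (k : ℕ∞) := by
  classical
  -- the exponent `E = (o − p) e_j + k e_i`
  set E : σ →₀ ℕ := Finsupp.single j (o - p) + Finsupp.single i k with hEdef
  have hEj : E j = o - p := by
    simp [hEdef, hij.symm]
  have hEi : E i = k := by
    simp [hEdef, hij]
  have herase : (Finset.univ : Finset σ).erase j = {i} := by
    ext l
    rw [Finset.mem_erase, Finset.mem_singleton]
    constructor
    · rintro ⟨hlj, -⟩
      rcases htwo l with h | h
      · exact absurd h hlj
      · exact h
    · intro h; rw [h]; exact ⟨hij, Finset.mem_univ i⟩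
  have hlam' : ∑ d ∈ s.F.support with d.degree = o,
      coeff d s.F * ∏ l ∈ univ.erase j, (((d l).choose (E l) : K) * b l ^ (d l - E l)) ≠ 0 := by
    have : ∀ d : σ →₀ ℕ, ∏ l ∈ univ.erase j, (((d l).choose (E l) : K) * b l ^ (d l - E l))
        = ((d i).choose k : K) * b i ^ (d i - k) := fun d => by
      rw [herase, Finset.prod_singleton, hEi]
    simp_rw [this]
    exact hlam
  have hord := ordZero_step_le_of_hasse_ne_zero p j b hbj s ho hlo hhi E hEj hlam'
  -- degrees: `|E| = (o − p) + k`, `|r'| = o − p`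
  have hEdeg : E.degree = (o - p) + k := by
    rw [degree_eq_add_sum_erase j E, herase, Finset.sum_singleton, hEj, hEi]
  have hr' : (step p j b s).r.degree = o - p := by
    rw [degree_eq_add_sum_erase j (step p j b s).r, herase, Finset.sum_singleton,
      MohWindowShadeTerminal.step_r_apply p j b hbj s ho j,
      MohWindowShadeTerminal.step_r_apply p j b hbj s ho i, if_pos hbj, if_pos rfl, if_neg hbi,
      add_zero]
  unfold State.shade
  rw [hr']
  calc ordZero (step p j b s).F - ((o - p : ℕ) : ℕ∞)
      ≤ (E.degree : ℕ∞) - ((o - p : ℕ) : ℕ∞) := tsub_le_tsub_right hord _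
    _ = (k : ℕ∞) := by
        rw [hEdeg, ← ENat.coe_sub]; exact_mod_cast (by omega : o - p + k - (o - p) = k)

end Summit.ResolutionOfSingularities.ResolutionOfSingularities.Theorems.CampaignW46.MohWindowShadeHasse
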